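import Literature.Analysis.ODE.ForcedSmoothDependence
import Mathlib.Analysis.SpecialFunctions.Exponential
import HarnessLib

/-!
# Constant-coefficient linear Volterra equations: the duality formula and two vanishing lemmas

Analysis/ODE support file (serves the provefact unit of
`Literature.MathematicalPhysics.KineticTheory.HeatConduction.CuneoEckmannHairerReyBellet2018_thm213`:
controllability of the linearised pinned chain through its dyadic noise skeleton, the algebraic
heart of a Hörmander-free local minorisation). Everything here is PROVED; no named facts.

For a bounded operator `A` on a Banach space `E` and a forcing `G ∈ C(I, E)` (`I = [0, 1]`),
the linear Volterra equation of `ForcedSmoothDependence.lean` with the CONSTANT operator curve `A`,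

  `w = G + V_A w`,  i.e.  `w(τ) = G(τ) + ∫₀^τ A w(s) ds`,

is the variational equation of a forced integral equation at an equilibrium. We prove:

* `volterra_const_duality` — **the duality (adjoint) formula**
  `ℓ(w(1)) = ℓ(G(1)) + ∫₀¹ ℓ(e^{(1-t)A} A G(t)) dt` for every continuous linear functional `ℓ`
  (differentiate `t ↦ ℓ(e^{(1-t)A} v(t))`, `v = w - G = ∫₀ A w`, using Mathlib's
  `hasDerivAt_exp_smul_const`);
* `volterra_const_duality_ramp` — its specialisation to ramp forcings `G(t) = (a min(c,t)) • b`: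
  `ℓ(w(1)) = a (c ℓ(b) + ∫₀¹ min(c,t) ψ(t) dt)` with `ψ(t) = ℓ(e^{(1-t)A} A b)`;
* `eq_zero_of_integral_min_mul_add_eq_zero` — **a calculus lemma**: if
  `∫₀¹ min(c,t) ψ(t) dt + c κ = 0` for all `c ∈ [0,1]` (`ψ` continuous) then `ψ = 0` on `[0,1]`
  and `κ = 0` (differentiate twice in `c`);
* `forall_Icc_of_forall_dyadic` — a continuous function on `[0,1]` vanishing at the dyadic
  rationals vanishes;
* `forall_apply_pow_eq_zero_of_exp` — **derivatives of the exponential**: if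
  `ℓ(e^{sA} v) = 0` for `s ∈ [0,1]` then `ℓ(Aᵏ v) = 0` for all `k` (the passage from
  "annihilates the reachable set" to "annihilates the Kalman vectors").

## References

* E. D. Sontag, *Mathematical Control Theory* (2nd ed., 1998), §3.1–3.3 (reachability of linear
  systems, the adjoint/duality computation, Kalman's rank condition). [folklore]
-/

noncomputable section

open Set Filter Topology MeasureTheory intervalIntegral unitInterval NormedSpace

universe u

namespace Literature.Analysis.ODE

/-! ### A calculus lemma on `[0, 1]` -/

/-- A function vanishing on the open interval `(0,1)` with a derivative at `c ∈ (0,1)` has zero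
derivative there. [folklore] -/
theorem deriv_eq_zero_of_eqOn_Ioo {f : ℝ → ℝ} {f' c : ℝ} (hc : c ∈ Ioo (0 : ℝ) 1)
    (hf : HasDerivAt f f' c) (h0 : ∀ x ∈ Ioo (0 : ℝ) 1, f x = 0) : f' = 0 := by
  have hzero : f =ᶠ[𝓝 c] fun _ => (0 : ℝ) := by
    filter_upwards [Ioo_mem_nhds hc.1 hc.2] with x hx
    exact h0 x hx
  exact hf.unique ((hasDerivAt_const c (0 : ℝ)).congr_of_eventuallyEq hzero)

/-- A continuous function vanishing on `(0, 1)` vanishes on `[0, 1]`. [folklore] -/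
theorem eqOn_Icc_of_eqOn_Ioo {f : ℝ → ℝ} (hf : Continuous f) (h0 : ∀ x ∈ Ioo (0 : ℝ) 1, f x = 0) :
    ∀ x ∈ Icc (0 : ℝ) 1, f x = 0 := by
  have hclosed : IsClosed {x : ℝ | f x = 0} := isClosed_eq hf continuous_const
  have hsub : Ioo (0 : ℝ) 1 ⊆ {x | f x = 0} := fun x hx => h0 x hx
  have h := hclosed.closure_subset_iff.2 hsub
  rw [closure_Ioo zero_ne_one] at h
  exact fun x hx => h hx

/-- **A calculus lemma.** If `ψ` is continuous and `∫₀¹ min(c, t) ψ(t) dt + c κ = 0` for every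
`c ∈ [0, 1]`, then `ψ = 0` on `[0, 1]` and `κ = 0`. (Write the left side as
`∫₀ᶜ tψ + c(Ψ(1) - Ψ(c)) + cκ`, `Ψ = ∫₀ ψ`; its derivative `Ψ(1) - Ψ(c) + κ` vanishes on `(0,1)`,
so `Ψ` is constant, hence `0`, hence `κ = 0` and `ψ = Ψ' = 0`.) [folklore] -/
theorem eq_zero_of_integral_min_mul_add_eq_zero {ψ : ℝ → ℝ} (hψ : Continuous ψ) {κ : ℝ}
    (h : ∀ c ∈ Icc (0 : ℝ) 1, (∫ t in (0 : ℝ)..1, min c t * ψ t) + c * κ = 0) :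
    (∀ t ∈ Icc (0 : ℝ) 1, ψ t = 0) ∧ κ = 0 := by
  -- the primitives `Ψ = ∫₀ ψ`, `M = ∫₀ t ψ(t) dt`
  set Ψ : ℝ → ℝ := fun c => ∫ t in (0 : ℝ)..c, ψ t with hΨ
  set M : ℝ → ℝ := fun c => ∫ t in (0 : ℝ)..c, t * ψ t with hM
  have htψ : Continuous fun t : ℝ => t * ψ t := continuous_id.mul hψ
  have hΨd : ∀ c, HasDerivAt Ψ (ψ c) c := fun c =>
    integral_hasDerivAt_right (hψ.intervalIntegrable 0 c) (hψ.stronglyMeasurableAtFilter _ _)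
      hψ.continuousAt
  have hMd : ∀ c, HasDerivAt M (c * ψ c) c := fun c =>
    integral_hasDerivAt_right (htψ.intervalIntegrable 0 c) (htψ.stronglyMeasurableAtFilter _ _)
      htψ.continuousAt
  have hΨc : Continuous Ψ := continuous_iff_continuousAt.2 fun c => (hΨd c).continuousAt
  -- rewrite the hypothesis: `Φ(c) = M(c) + c (Ψ 1 - Ψ c) + c κ = 0` on `[0, 1]`
  set Φ : ℝ → ℝ := fun c => M c + c * (Ψ 1 - Ψ c) + c * κ with hΦ
  have hsplit : ∀ c ∈ Icc (0 : ℝ) 1, (∫ t in (0 : ℝ)..1, min c t * ψ t) = M c + c * (Ψ 1 - Ψ c) := by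
    intro c hc
    have hint : ∀ a b, IntervalIntegrable (fun t => min c t * ψ t) volume a b := fun a b =>
      ((continuous_const.min continuous_id).mul hψ).intervalIntegrable a b
    rw [← integral_add_adjacent_intervals (hint 0 c) (hint c 1)]
    congr 1
    · refine integral_congr fun t ht => ?_
      rw [uIcc_of_le hc.1] at ht
      show min c t * ψ t = t * ψ t
      rw [min_eq_right ht.2]
    · have h1 : ∫ t in c..1, min c t * ψ t = ∫ t in c..1, c * ψ t := by
        refine integral_congr fun t ht => ?_
        rw [uIcc_of_le hc.2] at ht
        show min c t * ψ t = c * ψ t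
        rw [min_eq_left ht.1]
      rw [h1, intervalIntegral.integral_const_mul]
      congr 1
      rw [hΨ]
      simp only
      rw [eq_sub_iff_add_eq, add_comm,
        integral_add_adjacent_intervals (hψ.intervalIntegrable 0 c) (hψ.intervalIntegrable c 1)]
  have hΦ0 : ∀ c ∈ Icc (0 : ℝ) 1, Φ c = 0 := by
    intro c hc
    have := h c hc
    rw [hsplit c hc] at this
    simpa [hΦ] using this
  -- `Φ' = Ψ 1 - Ψ c + κ` vanishes on `(0, 1)`
  have hΦd : ∀ c, HasDerivAt Φ (Ψ 1 - Ψ c + κ) c := by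
    intro c
    have h1 : HasDerivAt (fun c => c * (Ψ 1 - Ψ c)) (1 * (Ψ 1 - Ψ c) + c * (0 - ψ c)) c :=
      (hasDerivAt_id c).mul ((hasDerivAt_const c (Ψ 1)).sub (hΨd c))
    have h2 : HasDerivAt (fun c => c * κ) (1 * κ) c := (hasDerivAt_id c).mul_const κ
    have h3 : HasDerivAt (fun c => M c + c * (Ψ 1 - Ψ c) + c * κ)
        (c * ψ c + (1 * (Ψ 1 - Ψ c) + c * (0 - ψ c)) + 1 * κ) c := ((hMd c).add h1).add h2
    have h4 : c * ψ c + (1 * (Ψ 1 - Ψ c) + c * (0 - ψ c)) + 1 * κ = Ψ 1 - Ψ c + κ := by ring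
    rw [h4] at h3
    exact h3
  have hconst : ∀ c ∈ Ioo (0 : ℝ) 1, Ψ 1 - Ψ c + κ = 0 := fun c hc =>
    deriv_eq_zero_of_eqOn_Ioo hc (hΦd c) fun x hx => hΦ0 x (Ioo_subset_Icc_self hx)
  -- `Ψ` is constant on `[0, 1]`, hence zero, hence `κ = 0`
  have hconst' : ∀ c ∈ Icc (0 : ℝ) 1, Ψ 1 - Ψ c + κ = 0 :=
    eqOn_Icc_of_eqOn_Ioo ((continuous_const.sub hΨc).add continuous_const) hconst
  have hΨ0 : Ψ 0 = 0 := by simp [hΨ]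
  have hκ : κ = 0 := by
    have h1 := hconst' 1 ⟨zero_le_one, le_rfl⟩
    rw [sub_self, zero_add] at h1
    exact h1
  have hΨ1 : Ψ 1 = 0 := by
    have h0 := hconst' 0 ⟨le_rfl, zero_le_one⟩
    rw [hΨ0, hκ, sub_zero, add_zero] at h0
    exact h0
  have hΨzero : ∀ c ∈ Icc (0 : ℝ) 1, Ψ c = 0 := by
    intro c hc
    have := hconst' c hc
    rw [hΨ1, hκ] at this
    linarith
  -- `ψ = Ψ' = 0`
  refine ⟨?_, hκ⟩
  have hopen : ∀ c ∈ Ioo (0 : ℝ) 1, ψ c = 0 := fun c hc =>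
    deriv_eq_zero_of_eqOn_Ioo hc (hΨd c) fun x hx => hΨzero x (Ioo_subset_Icc_self hx)
  exact eqOn_Icc_of_eqOn_Ioo hψ hopen

/-- **Dyadic density**: a function continuous on `[0, 1]` which vanishes at all dyadic rationals
`k/2ᵐ ≤ 1` vanishes on `[0, 1]`. [folklore] -/
theorem forall_Icc_of_forall_dyadic {Φ : ℝ → ℝ} (hΦ : ContinuousOn Φ (Icc 0 1))
    (h : ∀ m k : ℕ, k ≤ 2 ^ m → Φ ((k : ℝ) / 2 ^ m) = 0) : ∀ c ∈ Icc (0 : ℝ) 1, Φ c = 0 := by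
  intro c hc
  -- dyadic approximations from below
  set r : ℕ → ℝ := fun n => ((⌊c * 2 ^ n⌋₊ : ℕ) : ℝ) / 2 ^ n with hr
  have hrle : ∀ n, r n ≤ c := fun n => by
    rw [hr]
    simp only
    rw [div_le_iff₀ (pow_pos two_pos n)]
    exact Nat.floor_le (by have := hc.1; positivity)
  have hrge : ∀ n, c - 1 / 2 ^ n ≤ r n := fun n => by
    rw [hr]
    simp only
    rw [le_div_iff₀ (pow_pos two_pos n), sub_mul, div_mul_cancel₀ _ (pow_ne_zero n two_ne_zero)]
    exact (Nat.sub_one_lt_floor _).le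
  have hrmem : ∀ n, r n ∈ Icc (0 : ℝ) 1 := fun n =>
    ⟨by rw [hr]; positivity, (hrle n).trans hc.2⟩
  have hrzero : ∀ n, Φ (r n) = 0 := fun n => by
    refine h n _ ?_
    have h1 : ((⌊c * 2 ^ n⌋₊ : ℕ) : ℝ) ≤ 2 ^ n := by
      refine (Nat.floor_le (by have := hc.1; positivity)).trans ?_
      calc c * 2 ^ n ≤ 1 * 2 ^ n := by gcongr; exact hc.2
        _ = 2 ^ n := one_mul _
    exact_mod_cast h1
  have hconv : Tendsto r atTop (𝓝 c) := by
    have h0 : Tendsto (fun n : ℕ => c - 1 / 2 ^ n) atTop (𝓝 c) := by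
      have : Tendsto (fun n : ℕ => (1 / 2 : ℝ) ^ n) atTop (𝓝 0) :=
        tendsto_pow_atTop_nhds_zero_of_lt_one (by norm_num) (by norm_num)
      simpa using (tendsto_const_nhds (x := c)).sub this
    exact tendsto_of_tendsto_of_tendsto_of_le_of_le h0 tendsto_const_nhds hrge hrle
  have hlim : Tendsto (fun n => Φ (r n)) atTop (𝓝 (Φ c)) :=
    ((hΦ c hc).tendsto).comp (tendsto_nhdsWithin_iff.2 ⟨hconv, Eventually.of_forall hrmem⟩)
  simp only [hrzero] at hlim
  exact tendsto_nhds_unique hlim tendsto_const_nhds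

/-! ### Derivatives of the exponential: from the reachable set to the Kalman vectors -/

section Exponential

variable {E : Type u} [NormedAddCommGroup E] [NormedSpace ℝ E] [CompleteSpace E]

/-- `s ↦ e^{sA} v` has derivative `e^{sA} (A v)`. [folklore] -/
theorem hasDerivAt_exp_smul_apply (A : E →L[ℝ] E) (v : E) (s : ℝ) :
    HasDerivAt (fun u : ℝ => exp (u • A) v) (exp (s • A) (A v)) s := by
  have h := (hasDerivAt_exp_smul_const A s).clm_apply (hasDerivAt_const s v)
  simpa using h

/-- **If a functional annihilates `e^{sA} v` for `s ∈ [0,1]`, it annihilates all `Aᵏ v`.**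
(Induction: `s ↦ ℓ(e^{sA} Aᵏv)` vanishes on `[0,1]`, so its derivative `ℓ(e^{sA}Aᵏ⁺¹v)` vanishes
on `(0,1)`, hence on `[0,1]` by continuity; evaluate at `s = 0`.) [folklore] -/
theorem forall_apply_pow_eq_zero_of_exp (ℓ : E →L[ℝ] ℝ) (A : E →L[ℝ] E) (v : E)
    (h : ∀ s ∈ Icc (0 : ℝ) 1, ℓ (exp (s • A) v) = 0) : ∀ k : ℕ, ℓ ((A ^ k) v) = 0 := by
  have hclaim : ∀ k : ℕ, ∀ s ∈ Icc (0 : ℝ) 1, ℓ (exp (s • A) ((A ^ k) v)) = 0 := by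
    intro k
    induction k with
    | zero => simpa using h
    | succ k ih =>
      -- the derivative of the previous function
      have hd : ∀ s, HasDerivAt (fun u : ℝ => ℓ (exp (u • A) ((A ^ k) v)))
          (ℓ (exp (s • A) ((A ^ (k + 1)) v))) s := by
        intro s
        have h1 := ℓ.hasFDerivAt.comp_hasDerivAt s (hasDerivAt_exp_smul_apply A ((A ^ k) v) s)
        have h2 : A ((A ^ k) v) = (A ^ (k + 1)) v := by
          rw [pow_succ']
          rfl
        rw [h2] at h1
        exact h1
      have hcont : Continuous fun s : ℝ => ℓ (exp (s • A) ((A ^ (k + 1)) v)) :=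
        continuous_iff_continuousAt.2 fun s =>
          (ℓ.hasFDerivAt.comp_hasDerivAt s (hasDerivAt_exp_smul_apply A _ s)).continuousAt
      have hopen : ∀ s ∈ Ioo (0 : ℝ) 1, ℓ (exp (s • A) ((A ^ (k + 1)) v)) = 0 := fun s hs =>
        deriv_eq_zero_of_eqOn_Ioo hs (hd s) fun x hx => ih x (Ioo_subset_Icc_self hx)
      exact eqOn_Icc_of_eqOn_Ioo hcont hopen
  intro k
  have := hclaim k 0 ⟨le_rfl, zero_le_one⟩
  simpa using this

end Exponential

/-! ### The constant-coefficient Volterra equation: duality -/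

section Volterra

variable {E : Type u} [NormedAddCommGroup E] [NormedSpace ℝ E] [CompleteSpace E]

omit [CompleteSpace E] in
/-- Unfolding the constant-coefficient Volterra equation pointwise:
`w(τ) = G(τ) + ∫₀^τ A w(s̄) ds` (`s̄` the projection of `s` to `[0,1]`). [folklore] -/
theorem volterra_const_apply (A : E →L[ℝ] E) {w G : C(I, E)}
    (hw : w = G + volterraCLM (ContinuousMap.const I A) w) (τ : I) :
    w τ = G τ + ∫ s in (0 : ℝ)..(τ : ℝ), A (w (projIcc 0 1 zero_le_one s)) := by
  have h := congrArg (fun f : C(I, E) => f τ) hw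
  simp only [ContinuousMap.add_apply, volterraCLM_apply] at h
  rw [h]
  rfl

/-- **The duality formula for the constant-coefficient linear Volterra equation.** If
`w = G + V_A w` on `[0, 1]` then for every continuous linear functional `ℓ`,
`ℓ(w(1)) = ℓ(G(1)) + ∫₀¹ ℓ(e^{(1-t)A} A G(t)) dt`. Proof: `v(t) = ∫₀ᵗ A w` is `C¹` with
`v' = A w = A(G + v)` on `[0,1]`; the derivative of `t ↦ ℓ(e^{(1-t)A} v(t))` is
`ℓ(e^{(1-t)A} A G(t))`; integrate from `0` to `1`. [folklore] -/
theorem volterra_const_duality (A : E →L[ℝ] E) (ℓ : E →L[ℝ] ℝ) {w G : C(I, E)}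
    (hw : w = G + volterraCLM (ContinuousMap.const I A) w) :
    ℓ (w 1) = ℓ (G 1) +
      ∫ t in (0 : ℝ)..1, ℓ (exp ((1 - t) • A) (A (G (projIcc 0 1 zero_le_one t)))) := by
  -- the integrand of `v` and `v`
  set f : ℝ → E := fun s => A (w (projIcc 0 1 zero_le_one s)) with hf
  have hfc : Continuous f := A.continuous.comp ((map_continuous w).comp continuous_projIcc)
  set v : ℝ → E := fun t => ∫ s in (0 : ℝ)..t, f s with hv
  have hvd : ∀ t, HasDerivAt v (f t) t := fun t =>
    integral_hasDerivAt_right (hfc.intervalIntegrable 0 t) (hfc.stronglyMeasurableAtFilter _ _)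
      hfc.continuousAt
  have hvc : Continuous v := continuous_iff_continuousAt.2 fun t => (hvd t).continuousAt
  have hwv : ∀ τ : I, w τ = G τ + v τ := fun τ => volterra_const_apply A hw τ
  -- the operator curve `Φ t = e^{(1-t)A}` and its derivative
  set Φ : ℝ → E →L[ℝ] E := fun t => exp ((1 - t) • A) with hΦ
  have hΦd : ∀ t, HasDerivAt Φ (-(exp ((1 - t) • A) * A)) t := by
    intro t
    have h1 := (hasDerivAt_exp_smul_const A (1 - t)).scomp t ((hasDerivAt_id t).const_sub 1)
    simpa [Function.comp_def] using h1
  have hΦc : Continuous Φ := continuous_iff_continuousAt.2 fun t => (hΦd t).continuousAt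
  -- `F t = ℓ (Φ t (v t))` and its derivative
  set F : ℝ → ℝ := fun t => ℓ (Φ t (v t)) with hF
  set F' : ℝ → ℝ := fun t => ℓ ((-(exp ((1 - t) • A) * A)) (v t) + Φ t (f t)) with hF'
  have hFd : ∀ t, HasDerivAt F (F' t) t := fun t =>
    ℓ.hasFDerivAt.comp_hasDerivAt t ((hΦd t).clm_apply (hvd t))
  have hF'c : Continuous F' := by
    refine ℓ.continuous.comp (Continuous.add ?_ ?_)
    · exact ((hΦc.mul continuous_const).neg).clm_apply hvc
    · exact hΦc.clm_apply hfc
  -- fundamental theorem of calculus on `[0, 1]`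
  have hFTC : ∫ t in (0 : ℝ)..1, F' t = F 1 - F 0 :=
    integral_eq_sub_of_hasDerivAt (fun t _ => hFd t) (hF'c.intervalIntegrable 0 1)
  -- the derivative on `[0, 1]` is `ℓ (Φ t (A (G t)))`
  have hF'eq : ∀ t ∈ Icc (0 : ℝ) 1, F' t = ℓ (exp ((1 - t) • A) (A (G (projIcc 0 1 zero_le_one t)))) := by
    intro t ht
    have hproj : projIcc 0 1 zero_le_one t = ⟨t, ht⟩ := projIcc_of_mem zero_le_one ht
    have hvt : w (projIcc 0 1 zero_le_one t) = G (projIcc 0 1 zero_le_one t) + v t := by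
      rw [hwv, hproj]
    show ℓ (-(exp ((1 - t) • A) (A (v t))) +
        exp ((1 - t) • A) (A (w (projIcc 0 1 zero_le_one t)))) =
      ℓ (exp ((1 - t) • A) (A (G (projIcc 0 1 zero_le_one t))))
    rw [hvt]
    simp only [map_add, map_neg]
    abel
  have hint : ∫ t in (0 : ℝ)..1, F' t =
      ∫ t in (0 : ℝ)..1, ℓ (exp ((1 - t) • A) (A (G (projIcc 0 1 zero_le_one t)))) := by
    refine integral_congr fun t ht => ?_
    rw [uIcc_of_le zero_le_one] at ht
    exact hF'eq t ht
  -- endpoint values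
  have hF1 : F 1 = ℓ (v 1) := by simp [hF, hΦ]
  have hF0 : F 0 = 0 := by simp [hF, hv]
  have hw1 : w 1 = G 1 + v 1 := by
    have := hwv 1
    simpa using this
  rw [hw1, map_add, ← hint, hFTC, hF1, hF0, sub_zero]

/-- **Duality for ramp forcings.** If `w = G + V_A w` with `G(τ) = (a min(c, τ)) • b` for some
`c ∈ [0, 1]`, then `ℓ(w(1)) = a (c ℓ(b) + ∫₀¹ min(c,t) ℓ(e^{(1-t)A} A b) dt)`. [folklore] -/
theorem volterra_const_duality_ramp (A : E →L[ℝ] E) (ℓ : E →L[ℝ] ℝ) {w G : C(I, E)} (b : E)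
    {a c : ℝ} (hc : c ∈ Icc (0 : ℝ) 1) (hG : ∀ τ : I, G τ = (a * min c (τ : ℝ)) • b)
    (hw : w = G + volterraCLM (ContinuousMap.const I A) w) :
    ℓ (w 1) = a * (c * ℓ b + ∫ t in (0 : ℝ)..1, min c t * ℓ (exp ((1 - t) • A) (A b))) := by
  rw [volterra_const_duality A ℓ hw, hG 1]
  have h1 : min c ((1 : I) : ℝ) = c := by simp [hc.2]
  rw [h1, map_smul, smul_eq_mul]
  have hint : ∫ t in (0 : ℝ)..1, ℓ (exp ((1 - t) • A) (A (G (projIcc 0 1 zero_le_one t)))) =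
      ∫ t in (0 : ℝ)..1, a * (min c t * ℓ (exp ((1 - t) • A) (A b))) := by
    refine integral_congr fun t ht => ?_
    rw [uIcc_of_le zero_le_one] at ht
    have hproj : ((projIcc 0 1 zero_le_one t : I) : ℝ) = t := by
      rw [projIcc_of_mem zero_le_one ht]
    show ℓ (exp ((1 - t) • A) (A (G (projIcc 0 1 zero_le_one t)))) =
      a * (min c t * ℓ (exp ((1 - t) • A) (A b)))
    rw [hG, hproj, map_smul, map_smul, map_smul, smul_eq_mul]
    ring
  rw [hint, intervalIntegral.integral_const_mul]
  ring

end Volterra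

end Literature.Analysis.ODE
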